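/-
Copyright (c) 2026 the pub-hodgecm-mathlib formalisation cell (harness21).  Prover seat hodgecm-mathlib-K2Liu-p09 (g5): Track B «K2-LIT»,
hLiu418 = stmt-HodgeConjecture-24832; LEAD F0P6-plan RULINGS M-156m∕o, M-157a (4)∕c∕m «A7 = GK COCYCLE ROAD», file B7-M1.
-/
import Summits.HodgeConjecture.HodgeConjecture.Theorems.K2LiuSiegelCocycleChainLong         -- ★ B7-CC (+ the whole B4∕B7 chain)
import Summits.HodgeConjecture.HodgeConjecture.Theorems.K2LiuSiegelCocycleStageLetters      -- ★ B7-L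
import Summits.HodgeConjecture.HodgeConjecture.Theorems.K2LiuLocalRingPlaceDecomposition    -- ★ B7-R (K2Liu-p03 (g6)): (R1′)(R2)(R3)(R4)
import Summits.HodgeConjecture.HodgeConjecture.Theorems.K2LiuUnipDeltaRankOneHaar           -- ★ `continuous_matA`
import HarnessLib

/-!
# Crux `HLiu418`, road `K2_Liu`, organ A7-reg (GK cocycle road), file B7-M1:
# SET-UP FOR THE ASSEMBLY — `N_Δ(F_v)` is closed (the volume `νN(N_Δ ∩ K₀)` is positive), smooth functions are continuous, the partial Weyl letters
# exist, and the middle word `φ(w₁) φ(u₋(z))` factors through the places above `v`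

Cell `hodgecm-mathlib`, crux item hLiu418 = `stmt-HodgeConjecture-24832`; squad K2 ∕ K2Liu; prover K2Liu-p09 (g5).  THEOREMS ONLY; lane
`--supports stmt-HodgeConjecture-24832` (count-neutral helper).  ONE FRAME (RULING M-156o (c)).
* §1 `isClosed_unipDeltaLocal` (every rank; ★ `continuous_matA`), `volume_inter_ne_zero`: `νN.real {u ∈ N_Δ | u ∈ K₀} ≠ 0` for `K₀` compact open and `νN` Haar
  (the `vol` of ★ T1 `aNorm`, ★ B7-prep `eq_aNorm_two_mul`); `continuous_of_isSmooth`.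
* §2 the partial Weyl letters: `exists_partialWeylGL w : ∃ A ∈ GL₂(E ⊗ F_v), A = (1−1_w 1_w; 1_w 1−1_w)`.
* §3 the middle word through the places: non-split `φ(w₁) φ(u₋(z)) = φ(P_w) φ(u₋(1_w z_w))`; split
  `φ(w₁) φ(u₋(z)) g = φ(P_{w₁}) φ(u₋(1_{w₁} z_{w₁})) (φ(P_{w₂}) φ(u₋(1_{w₂} z_{w₂})) g)` (★ B4c-2 `leviElt_eq_weylOne`, `leviElt_partialWeyl_mul_partialWeyl`,
  `leviElt_partialWeyl_mul_uMinus_comm`).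
HONEST LABEL.  `HC_CM` is proved only modulo the 7 printed citations (2 remaining named inputs: hLiu418 = `stmt-HodgeConjecture-24832`,
h413 = `stmt-HodgeConjecture-24833`) until rung 0 closes.

## References
* [HarrisKudlaSweet1996] M. Harris, S. Kudla, W. J. Sweet, J. AMS 9 (1996), §1 (1.11)–(1.15), §6 (6.16).
* [Kudla1994] S. Kudla, *Splitting metaplectic covers of dual reductive pairs*, Israel J. Math. 87 (1994), §3 (`N_Δ` by block conditions).
* [BushnellHenniart2006] C. Bushnell, G. Henniart, *The local Langlands conjecture for GL(2)* (2006), §1.1 (smooth = locally constant).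
-/

set_option autoImplicit false
set_option linter.dupNamespace false -- the mandated namespace repeats `HodgeConjecture.HodgeConjecture`

noncomputable section

open scoped Classical NNReal ENNReal
open NumberField IsDedekindDomain Matrix MeasureTheory Topology
open Literature.NumberTheory.Automorphic Literature.NumberTheory.Automorphic.UnitaryGroup
open Literature.NumberTheory.GelbartRogawski1991 Literature.NumberTheory.GelbartRogawski1991.AdaptedBlocks
open Literature.NumberTheory.GelbartRogawski1991.UnitaryDualPair.LocalSplitting
open Literature.NumberTheory.K2Lit.LocalSiegelDoubled
open Summit.HodgeConjecture.HodgeConjecture.Cruxes.HLiu418.K2LiuLocalSiegelIwasawaFrame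
open Summit.HodgeConjecture.HodgeConjecture.Cruxes.HLiu418.K2LiuLocalSiegelIwasawa
open Summit.HodgeConjecture.HodgeConjecture.Cruxes.HLiu418.K2LiuDoubledUTwoTwoBorelFrame
open Summit.HodgeConjecture.HodgeConjecture.Cruxes.HLiu418.K2LiuDoubledUTwoTwoWeylCocycle
open Summit.HodgeConjecture.HodgeConjecture.Cruxes.HLiu418.K2LiuDoubledUTwoTwoLevi
open Summit.HodgeConjecture.HodgeConjecture.Cruxes.HLiu418.K2LiuDoubledUTwoTwoFrameTransport
open Summit.HodgeConjecture.HodgeConjecture.Cruxes.HLiu418.K2LiuDoubledUTwoTwoRankOneRelationsLevi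
open Summit.HodgeConjecture.HodgeConjecture.Cruxes.HLiu418.K2LiuSiegelCocycleStageShort
open Summit.HodgeConjecture.HodgeConjecture.Cruxes.HLiu418.K2LiuUnipDeltaRankOneHaar

namespace Summit.HodgeConjecture.HodgeConjecture.Cruxes.HLiu418.K2LiuA7NormalisedRegularitySetup

variable (F : Type) [Field F] [NumberField F] (E : Type) [Field E] [NumberField E] [Algebra F E]
  [Algebra.IsQuadraticExtension F E] (c : E ≃ₐ[F] E)
  {δ : E} (hcδ : c δ = -δ) (hδ : δ ≠ 0) (v : HeightOneSpectrum (𝓞 F))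

/-! ## §1 `N_Δ(F_v)` is closed; the volume `νN(N_Δ ∩ K₀)`; smooth functions are continuous -/

section Closed

variable (n : ℕ) {JD : Matrix (Fin (n + n)) (Fin (n + n)) E}

omit [Algebra.IsQuadraticExtension F E] in
/-- **`N_Δ(F_v)` is closed in `H(F_v)`**: it is cut out by the block conditions `C = 0`, `A = 1`, `D = 1` on the continuous `matA` (★ `mem_unipDeltaLocal_iff_blocks`,
★ `continuous_matA`). [cite: Kudla1994, §3] [cite: HarrisKudlaSweet1996, §1 (1.11)] -/
theorem isClosed_unipDeltaLocal : IsClosed (unipDeltaLocal F E c v n (JD := JD) : Set (UnitaryGroup.localPi E c (n + n) JD v)) := by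
  have hset : (unipDeltaLocal F E c v n (JD := JD) : Set (UnitaryGroup.localPi E c (n + n) JD v)) =
      {u | blkC (matA F E c v n u) = 0} ∩ ({u | blkA (matA F E c v n u) = 1} ∩ {u | blkD (matA F E c v n (JD := JD) u) = 1}) := by
    ext u
    simp only [SetLike.mem_coe, mem_unipDeltaLocal_iff_blocks, Set.mem_inter_iff, Set.mem_setOf_eq]
  have hc := continuous_matA F E c v n (JD := JD)
  have hA : Continuous fun M : Matrix (Fin n ⊕ Fin n) (Fin n ⊕ Fin n) (UnitaryGroup.LocalRing E v) => blkA M := by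
    refine continuous_pi fun i => continuous_pi fun j => ?_
    simp only [blkA, Matrix.smul_apply, Matrix.add_apply, Matrix.toBlocks₁₁, Matrix.toBlocks₁₂, Matrix.toBlocks₂₁, Matrix.toBlocks₂₂, Matrix.of_apply]
    fun_prop
  have hC : Continuous fun M : Matrix (Fin n ⊕ Fin n) (Fin n ⊕ Fin n) (UnitaryGroup.LocalRing E v) => blkC M := by
    refine continuous_pi fun i => continuous_pi fun j => ?_
    simp only [blkC, Matrix.smul_apply, Matrix.add_apply, Matrix.sub_apply, Matrix.toBlocks₁₁, Matrix.toBlocks₁₂, Matrix.toBlocks₂₁, Matrix.toBlocks₂₂,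
      Matrix.of_apply]
    fun_prop
  have hD : Continuous fun M : Matrix (Fin n ⊕ Fin n) (Fin n ⊕ Fin n) (UnitaryGroup.LocalRing E v) => blkD M := by
    refine continuous_pi fun i => continuous_pi fun j => ?_
    simp only [blkD, Matrix.smul_apply, Matrix.add_apply, Matrix.sub_apply, Matrix.toBlocks₁₁, Matrix.toBlocks₁₂, Matrix.toBlocks₂₁, Matrix.toBlocks₂₂,
      Matrix.of_apply]
    fun_prop
  rw [hset]
  exact (isClosed_eq (hC.comp hc) continuous_const).inter ((isClosed_eq (hA.comp hc) continuous_const).inter (isClosed_eq (hD.comp hc) continuous_const))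

omit [Algebra.IsQuadraticExtension F E] in
/-- **the volume factor of the face is non-zero**: `νN.real {u ∈ N_Δ(F_v) | u ∈ K₀} ≠ 0` for a Haar measure `νN` on `N_Δ(F_v)` and a compact open subgroup `K₀ ≤ H(F_v)`
(open ⟹ positive measure; `N_Δ` closed and `K₀` compact ⟹ finite measure). [cite: HarrisKudlaSweet1996, §6 (6.14)] -/
theorem volume_inter_ne_zero [MeasurableSpace (unipDeltaLocal F E c v n (JD := JD))] [BorelSpace (unipDeltaLocal F E c v n (JD := JD))]
    (νN : Measure (unipDeltaLocal F E c v n (JD := JD))) [νN.IsHaarMeasure] (K₀ : Subgroup (UnitaryGroup.localPi E c (n + n) JD v))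
    (hK₀ : IsCompact (K₀ : Set (UnitaryGroup.localPi E c (n + n) JD v)) ∧ IsOpen (K₀ : Set (UnitaryGroup.localPi E c (n + n) JD v))) :
    νN.real {u : unipDeltaLocal F E c v n (JD := JD) | (u : UnitaryGroup.localPi E c (n + n) JD v) ∈ K₀} ≠ 0 := by
  have hopen : IsOpen {u : unipDeltaLocal F E c v n (JD := JD) | (u : UnitaryGroup.localPi E c (n + n) JD v) ∈ K₀} :=
    hK₀.2.preimage continuous_subtype_val
  have hcpt : IsCompact {u : unipDeltaLocal F E c v n (JD := JD) | (u : UnitaryGroup.localPi E c (n + n) JD v) ∈ K₀} :=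
    (isClosed_unipDeltaLocal F E c v n (JD := JD)).isClosedEmbedding_subtypeVal.isCompact_preimage hK₀.1
  refine (ENNReal.toReal_pos (hopen.measure_pos νN ⟨1, K₀.one_mem⟩).ne' hcpt.measure_lt_top.ne).ne'

omit [Algebra.IsQuadraticExtension F E] in
/-- **a smooth function is continuous** (it is constant on the cosets `h·U` of its open smoothness group). [cite: BushnellHenniart2006, §1.1] -/
theorem continuous_of_isSmooth {f : UnitaryGroup.localPi E c (n + n) JD v → ℂ} (hf : IsSmooth F E c v n f) : Continuous f := by
  obtain ⟨U, hU⟩ := hf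
  refine ((IsLocallyConstant.iff_eventually_eq f).2 fun h => ?_).continuous
  refine Filter.mem_of_superset ((U.isOpen.preimage (show Continuous (fun y : UnitaryGroup.localPi E c (n + n) JD v => h⁻¹ * y) from
    continuous_const.mul continuous_id)).mem_nhds ?_) fun y hy => ?_
  · simp only [Set.mem_preimage, inv_mul_cancel]; exact U.one_mem
  · have hy' := hU h (h⁻¹ * y) hy
    rwa [mul_inv_cancel_left] at hy'

end Closed


/-! ## §2 The partial Weyl letters exist in `GL₂(E ⊗ F_v)` -/

section Letters

omit [NumberField F] [Algebra.IsQuadraticExtension F E] in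
/-- `W = (0 1; 1 0)` squares to `1`. [cite: HarrisKudlaSweet1996, §1 (1.12)] -/
theorem antidiagTwo'_mul_self : (!![0, 1; 1, 0] : Matrix (Fin 2) (Fin 2) (UnitaryGroup.LocalRing E v)) * !![0, 1; 1, 0] = 1 := by
  rw [Matrix.mul_fin_two, Matrix.one_fin_two]; simp

omit [NumberField F] [Algebra.IsQuadraticExtension F E] in
/-- **the Weyl letter of the Levi as a `GL₂` element**: `∃ C ∈ GL₂(E ⊗ F_v)` with matrix `(0 1; 1 0)`. [cite: HarrisKudlaSweet1996, §1 (1.12)] -/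
theorem exists_weylOneGL : ∃ C : GL (Fin 2) (UnitaryGroup.LocalRing E v), C.val = !![0, 1; 1, 0] :=
  ⟨⟨!![0, 1; 1, 0], !![0, 1; 1, 0], antidiagTwo'_mul_self F E v, antidiagTwo'_mul_self F E v⟩, rfl⟩

omit [NumberField F] [Algebra.IsQuadraticExtension F E] in
/-- **the partial Weyl letter at `w` as a `GL₂` element**: `∃ A ∈ GL₂(E ⊗ F_v)` with matrix `(1−1_w 1_w; 1_w 1−1_w)` (an involution since `1_w` is idempotent).
[cite: HarrisKudlaSweet1996, §6 (6.16)] -/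
theorem exists_partialWeylGL (w : PlacesOver E v) :
    ∃ A : GL (Fin 2) (UnitaryGroup.LocalRing E v), A.val = !![1 - Pi.single w 1, Pi.single w 1; Pi.single w 1, 1 - Pi.single w 1] := by
  have hε := single_one_mul_single_one F E v w
  have hM : (!![1 - Pi.single w 1, Pi.single w 1; Pi.single w 1, 1 - Pi.single w 1] : Matrix (Fin 2) (Fin 2) (UnitaryGroup.LocalRing E v)) =
      (Pi.single w (1 : w.1.adicCompletion E) : UnitaryGroup.LocalRing E v) • !![0, 1; 1, 0] +
        ((1 : UnitaryGroup.LocalRing E v) - Pi.single w (1 : w.1.adicCompletion E)) • (1 : Matrix (Fin 2) (Fin 2) (UnitaryGroup.LocalRing E v)) :=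
    Matrix.ext fun i j => by fin_cases i <;> fin_cases j <;> simp
  have hMM : (!![1 - Pi.single w 1, Pi.single w 1; Pi.single w 1, 1 - Pi.single w 1] : Matrix (Fin 2) (Fin 2) (UnitaryGroup.LocalRing E v)) *
      !![1 - Pi.single w 1, Pi.single w 1; Pi.single w 1, 1 - Pi.single w 1] = 1 := by
    rw [hM, comb_mul_comb hε, antidiagTwo'_mul_self F E v, one_mul, ← add_smul, add_sub_cancel, one_smul]
  exact ⟨⟨_, _, hMM, hMM⟩, rfl⟩

end Letters

/-! ## §3 The middle word `φ(w₁) φ(u₋(z))` through the places above `v` -/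

section Word

variable {T₂ : Matrix (Fin 2) (Fin 2) F} {J₂D : Matrix (Fin (2 + 2)) (Fin (2 + 2)) E} (hJ₂D : J₂D = (gramD F 2 T₂).map (algebraMap F E))
  (Q : GL (Fin (2 + 2)) F)
  (hQ : (Q : Matrix (Fin (2 + 2)) (Fin (2 + 2)) F)ᵀ * gramD F 2 T₂ * (Q : Matrix (Fin (2 + 2)) (Fin (2 + 2)) F) = (StdForm.antidiagonal (2 + 2)).over F)

omit [NumberField F] [Algebra.IsQuadraticExtension F E] in
/-- non-split: `1_w = 1`. [cite: CasselsFrohlichANT1967, Ch. II §11] -/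
theorem single_one_eq_one {w : PlacesOver E v} (hw : ∀ w' : PlacesOver E v, w' = w) : (Pi.single w (1 : w.1.adicCompletion E) : UnitaryGroup.LocalRing E v) = 1 := by
  funext w'; obtain rfl := hw w'; rw [Pi.single_eq_same, Pi.one_apply]

omit [NumberField F] [Algebra.IsQuadraticExtension F E] in
/-- non-split: `z = 1_w(z_w)`. [cite: CasselsFrohlichANT1967, Ch. II §11] -/
theorem eq_single {w : PlacesOver E v} (hw : ∀ w' : PlacesOver E v, w' = w) (z : UnitaryGroup.LocalRing E v) : z = Pi.single w (z w) := by
  funext w'; obtain rfl := hw w'; rw [Pi.single_eq_same]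

include hcδ hδ in
/-- **non-split: `φ(P_w) φ(u₋(1_w z_w)) = φ(w₁) φ(u₋(z))`** (`P_w = m(0 1; 1 0) = w₁`, ★ `leviElt_eq_weylOne`). [cite: HarrisKudlaSweet1996, §1 (1.12), §6 (6.16)] -/
theorem frameConj_partialWeyl_mul_uMinus_of_forall_eq {w : PlacesOver E v} (hw : ∀ w' : PlacesOver E v, w' = w) (A : GL (Fin 2) (UnitaryGroup.LocalRing E v))
    (hA : A.val = !![1 - Pi.single w 1, Pi.single w 1; Pi.single w 1, 1 - Pi.single w 1]) (z : UnitaryGroup.LocalRing E v) :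
    FrameTransport.frameConj F E c v (2 + 2) hJ₂D (antidiagonal_over_eq_map F E 2) Q hQ (toLocalFour F E c v (leviElt (UnitaryGroup.LocalRing E v) (UnitaryGroup.conjLocal E c v) (UnitaryGroup.conjLocal_conjLocal c v hcδ hδ) A)) *
        FrameTransport.frameConj F E c v (2 + 2) hJ₂D (antidiagonal_over_eq_map F E 2) Q hQ (toLocalFour F E c v (uMinus (UnitaryGroup.LocalRing E v) (UnitaryGroup.conjLocal E c v) (UnitaryGroup.conjLocal_conjLocal c v hcδ hδ) (Pi.single w (z w)))) =
      FrameTransport.frameConj F E c v (2 + 2) hJ₂D (antidiagonal_over_eq_map F E 2) Q hQ (toLocalFour F E c v (weylOne (UnitaryGroup.LocalRing E v) (UnitaryGroup.conjLocal E c v))) * FrameTransport.frameConj F E c v (2 + 2) hJ₂D (antidiagonal_over_eq_map F E 2) Q hQ (toLocalFour F E c v (uMinus (UnitaryGroup.LocalRing E v) (UnitaryGroup.conjLocal E c v) (UnitaryGroup.conjLocal_conjLocal c v hcδ hδ) z)) := by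
  have hA' : A.val = !![0, 1; 1, 0] := by rw [hA, single_one_eq_one F E v hw, sub_self]
  rw [leviElt_eq_weylOne _ _ (UnitaryGroup.conjLocal_conjLocal c v hcδ hδ) A hA', ← eq_single F E v hw z]

omit [NumberField F] [Algebra.IsQuadraticExtension F E] in
/-- split: `1_{w₁} + 1_{w₂} = 1`. [cite: CasselsFrohlichANT1967, Ch. II §11] -/
theorem single_one_add_single_one {w₁ w₂ : PlacesOver E v} (hne : w₁ ≠ w₂) (hw : ∀ w' : PlacesOver E v, w' = w₁ ∨ w' = w₂) :
    (Pi.single w₁ (1 : w₁.1.adicCompletion E) : UnitaryGroup.LocalRing E v) + Pi.single w₂ (1 : w₂.1.adicCompletion E) = 1 := by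
  funext w'
  rw [Pi.add_apply, Pi.one_apply]
  rcases hw w' with rfl | rfl
  · rw [Pi.single_eq_same, Pi.single_eq_of_ne hne, add_zero]
  · rw [Pi.single_eq_same, Pi.single_eq_of_ne (Ne.symm hne), zero_add]

omit [NumberField F] [Algebra.IsQuadraticExtension F E] in
/-- split: `z = 1_{w₁}(z_{w₁}) + 1_{w₂}(z_{w₂})`. [cite: CasselsFrohlichANT1967, Ch. II §11] -/
theorem eq_single_add_single {w₁ w₂ : PlacesOver E v} (hne : w₁ ≠ w₂) (hw : ∀ w' : PlacesOver E v, w' = w₁ ∨ w' = w₂) (z : UnitaryGroup.LocalRing E v) :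
    z = Pi.single w₁ (z w₁) + Pi.single w₂ (z w₂) := by
  funext w'
  rw [Pi.add_apply]
  rcases hw w' with rfl | rfl
  · rw [Pi.single_eq_same, Pi.single_eq_of_ne hne, add_zero]
  · rw [Pi.single_eq_same, Pi.single_eq_of_ne (Ne.symm hne), zero_add]

include hcδ hδ in
/-- **split: `φ(w₁) φ(u₋(z)) g = φ(P_{w₁}) φ(u₋(1_{w₁} z_{w₁})) (φ(P_{w₂}) φ(u₋(1_{w₂} z_{w₂})) g)`** (`w₁ = P_{w₁} P_{w₂}`, ★ `leviElt_partialWeyl_mul_partialWeyl`; `P_{w₂}` commutes with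
`u₋(1_{w₁} ·)`, ★ `leviElt_partialWeyl_mul_uMinus_comm`). [cite: HarrisKudlaSweet1996, §6 (6.16)] -/
theorem frameConj_weylOne_mul_uMinus_of_pair {w₁ w₂ : PlacesOver E v} (hne : w₁ ≠ w₂) (hw : ∀ w' : PlacesOver E v, w' = w₁ ∨ w' = w₂)
    (A₁ A₂ : GL (Fin 2) (UnitaryGroup.LocalRing E v)) (hA₁ : A₁.val = !![1 - Pi.single w₁ 1, Pi.single w₁ 1; Pi.single w₁ 1, 1 - Pi.single w₁ 1])
    (hA₂ : A₂.val = !![1 - Pi.single w₂ 1, Pi.single w₂ 1; Pi.single w₂ 1, 1 - Pi.single w₂ 1]) (z : UnitaryGroup.LocalRing E v) (g : UnitaryGroup.localPi E c (2 + 2) J₂D v) :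
    FrameTransport.frameConj F E c v (2 + 2) hJ₂D (antidiagonal_over_eq_map F E 2) Q hQ (toLocalFour F E c v (weylOne (UnitaryGroup.LocalRing E v) (UnitaryGroup.conjLocal E c v))) * FrameTransport.frameConj F E c v (2 + 2) hJ₂D (antidiagonal_over_eq_map F E 2) Q hQ (toLocalFour F E c v (uMinus (UnitaryGroup.LocalRing E v) (UnitaryGroup.conjLocal E c v) (UnitaryGroup.conjLocal_conjLocal c v hcδ hδ) z)) * g =
      FrameTransport.frameConj F E c v (2 + 2) hJ₂D (antidiagonal_over_eq_map F E 2) Q hQ (toLocalFour F E c v (leviElt (UnitaryGroup.LocalRing E v) (UnitaryGroup.conjLocal E c v) (UnitaryGroup.conjLocal_conjLocal c v hcδ hδ) A₁)) * FrameTransport.frameConj F E c v (2 + 2) hJ₂D (antidiagonal_over_eq_map F E 2) Q hQ (toLocalFour F E c v (uMinus (UnitaryGroup.LocalRing E v) (UnitaryGroup.conjLocal E c v) (UnitaryGroup.conjLocal_conjLocal c v hcδ hδ) (Pi.single w₁ (z w₁)))) *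
        (FrameTransport.frameConj F E c v (2 + 2) hJ₂D (antidiagonal_over_eq_map F E 2) Q hQ (toLocalFour F E c v (leviElt (UnitaryGroup.LocalRing E v) (UnitaryGroup.conjLocal E c v) (UnitaryGroup.conjLocal_conjLocal c v hcδ hδ) A₂)) * FrameTransport.frameConj F E c v (2 + 2) hJ₂D (antidiagonal_over_eq_map F E 2) Q hQ (toLocalFour F E c v (uMinus (UnitaryGroup.LocalRing E v) (UnitaryGroup.conjLocal E c v) (UnitaryGroup.conjLocal_conjLocal c v hcδ hδ) (Pi.single w₂ (z w₂)))) * g) := by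
  obtain ⟨C, hC⟩ := exists_weylOneGL F E v
  have hC' : C.val = !![1 - ((Pi.single w₁ (1 : w₁.1.adicCompletion E) : UnitaryGroup.LocalRing E v) + Pi.single w₂ (1 : w₂.1.adicCompletion E)),
      (Pi.single w₁ (1 : w₁.1.adicCompletion E) : UnitaryGroup.LocalRing E v) + Pi.single w₂ (1 : w₂.1.adicCompletion E);
      (Pi.single w₁ (1 : w₁.1.adicCompletion E) : UnitaryGroup.LocalRing E v) + Pi.single w₂ (1 : w₂.1.adicCompletion E),
      1 - ((Pi.single w₁ (1 : w₁.1.adicCompletion E) : UnitaryGroup.LocalRing E v) + Pi.single w₂ (1 : w₂.1.adicCompletion E))] := by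
    rw [hC, single_one_add_single_one F E v hne hw, sub_self]
  have hword : weylOne (UnitaryGroup.LocalRing E v) (UnitaryGroup.conjLocal E c v) * uMinus (UnitaryGroup.LocalRing E v) (UnitaryGroup.conjLocal E c v) (UnitaryGroup.conjLocal_conjLocal c v hcδ hδ) z =
      leviElt (UnitaryGroup.LocalRing E v) (UnitaryGroup.conjLocal E c v) (UnitaryGroup.conjLocal_conjLocal c v hcδ hδ) A₁ * uMinus (UnitaryGroup.LocalRing E v) (UnitaryGroup.conjLocal E c v) (UnitaryGroup.conjLocal_conjLocal c v hcδ hδ) (Pi.single w₁ (z w₁)) *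
        (leviElt (UnitaryGroup.LocalRing E v) (UnitaryGroup.conjLocal E c v) (UnitaryGroup.conjLocal_conjLocal c v hcδ hδ) A₂ * uMinus (UnitaryGroup.LocalRing E v) (UnitaryGroup.conjLocal E c v) (UnitaryGroup.conjLocal_conjLocal c v hcδ hδ) (Pi.single w₂ (z w₂))) := by
    have hcomm : leviElt (UnitaryGroup.LocalRing E v) (UnitaryGroup.conjLocal E c v) (UnitaryGroup.conjLocal_conjLocal c v hcδ hδ) A₂ * uMinus (UnitaryGroup.LocalRing E v) (UnitaryGroup.conjLocal E c v) (UnitaryGroup.conjLocal_conjLocal c v hcδ hδ) (Pi.single w₁ (z w₁)) =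
        uMinus (UnitaryGroup.LocalRing E v) (UnitaryGroup.conjLocal E c v) (UnitaryGroup.conjLocal_conjLocal c v hcδ hδ) (Pi.single w₁ (z w₁)) * leviElt (UnitaryGroup.LocalRing E v) (UnitaryGroup.conjLocal E c v) (UnitaryGroup.conjLocal_conjLocal c v hcδ hδ) A₂ := by
      have h := leviElt_partialWeyl_mul_uMinus_comm (UnitaryGroup.conjLocal_conjLocal c v hcδ hδ) ((mul_comm _ _).trans (single_one_mul_single_one_of_ne F E v w₁ hne))
        (Pi.single w₁ (z w₁)) A₂ hA₂
      rwa [single_one_mul_single] at h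
    conv_lhs => rw [eq_single_add_single F E v hne hw z, ← uMinus_mul, ← leviElt_eq_weylOne _ _ (UnitaryGroup.conjLocal_conjLocal c v hcδ hδ) C hC,
      ← leviElt_partialWeyl_mul_partialWeyl (UnitaryGroup.conjLocal_conjLocal c v hcδ hδ) (single_one_mul_single_one_of_ne F E v w₁ hne) A₁ A₂ C hA₁ hA₂ hC']
    rw [← mul_assoc, mul_assoc (leviElt _ _ _ A₁), hcomm]
    simp only [mul_assoc]
  have h := congrArg (fun g' => FrameTransport.frameConj F E c v (2 + 2) hJ₂D (antidiagonal_over_eq_map F E 2) Q hQ (toLocalFour F E c v g') * g) hword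
  simp only [map_mul, mul_assoc] at h ⊢
  exact h

end Word

end Summit.HodgeConjecture.HodgeConjecture.Cruxes.HLiu418.K2LiuA7NormalisedRegularitySetup

end
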